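import Literature.AlgebraicGeometry.Frobenioids.Thm42Sub
import Literature.AlgebraicGeometry.Frobenioids.PrimaryStepsTransport
import Literature.AlgebraicGeometry.Frobenioids.FrobeniusTypeIsotropic
import HarnessLib

/-!
# [FrdI] Theorem 4.2, sub-DAG rows T42-L01 and T42-L04 — discharges

Mochizuki, *The geometry of Frobenioids I: the general theory*, Kyushu J. Math. **62** (2008)
293–400, §4, Theorem 4.2 (i), proof p. 78 [cite: MochizukiFrdI2008, Thm. 4.2 (i) p.78].
PROOF-ONLY companion of `Thm42Sub.lean`: `FrdI.T42.GroupLikeWLOG` (row L01: group-like objects are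
Div-Frobenius-trivial with Div-identity endomorphisms and invertible pre-steps — from the tree's
Prop. 1.10 (vi) `PreFrobenioid.isFrobeniusTrivial_of_isGroupLikeObj_of_isOfIsotropicType`, seat
abc-iut-L1-t1) and `FrdI.T42.PrimaryStepsAtDivFrobTrivial` (row L04: primary steps to / from / through a
Div-Frobenius-trivial object, perfect type — from `PrimaryStepsTransport.lean`). No new definitions.
-/

namespace Literature.AlgebraicGeometry.Frobenioids

open CategoryTheory Opposite

namespace FrdI.T42

/-- **Row T42-L01 DISCHARGED** (p. 78 ll. 28–35; Prop. 1.10 (vi), Prop. 1.4 (i)(iii)).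
[cite: MochizukiFrdI2008, Thm. 4.2 (i) p.78] -/
theorem GroupLikeWLOG_holds : GroupLikeWLOG := by
  intro D _ Φ C _ F hF histr A hA
  have hP := hF.isPreFrobenioid
  -- endomorphisms of a group-like object are Div-identity: `Φ(A_D)` is trivial
  have hdiv : ∀ α : A ⟶ A, PreFrobenioid.IsDivIdentity F α := fun α =>
    MonoidHom.ext fun x => by rw [hA x, map_one]; exact (hA _).symm
  refine ⟨?_, hdiv, ?_, ?_⟩
  · obtain ⟨ζ, hζ⟩ := PreFrobenioid.isFrobeniusTrivial_of_isGroupLikeObj_of_isOfIsotropicType hF histr hA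
    exact ⟨ζ, fun n => ⟨(hζ n).1, hdiv _, (hζ n).2.2⟩⟩
  · intro B φ hφ
    have hB : PreFrobenioid.IsGroupLikeObj F B := PreFrobenioid.isGroupLikeObj_of_isBaseIso φ hφ.2 hA
    exact histr B φ (hB _) hφ
  · intro B φ hφ
    exact histr A φ (hA _) hφ

/-- **Row T42-L04 DISCHARGED** (p. 78 ll. 47–53; Prop. 4.1 (i)(ii)): `PrimaryStepsTransport.lean`.
[cite: MochizukiFrdI2008, Thm. 4.2 (i) p.78] -/
theorem PrimaryStepsAtDivFrobTrivial_holds : PrimaryStepsAtDivFrobTrivial := by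
  intro D₁ _ Φ₁ C₁ _ D₂ _ Φ₂ C₂ _ F₁ F₂ Ψ S A α hα hα₂
  have hinto : ∀ ⦃B : C₁⦄ (φ : B ⟶ A), PreFrobenioid.IsStep F₁ φ →
      PreFrobenioid.IsPrimaryPreStep F₁ φ → PreFrobenioid.IsPrimaryPreStep F₂ (Ψ.functor.map φ) :=
    fun B φ hφ hp => PreFrobenioid.isPrimaryPreStep_map_of_divFrobeniusTrivial Ψ S.isFrobenioid₁
      S.isFrobenioid₂ S.perfect₁ S.perfect₂ S.isotropic₁ S.isotropic₂ S.step_map S.step_inv S.preStep_map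
      S.frobeniusType_map α hα hα₂ hφ hp
  refine ⟨hinto, fun B ψ hψ hψp => ?_, fun B B' φ ψ hφ hφp hψ hc hψp => ?_⟩
  · exact PreFrobenioid.isPrimaryPreStep_map_of_from Ψ S.isFrobenioid₁ S.isFrobenioid₂ S.perfect₁
      S.perfect₂ S.isotropic₁ S.isotropic₂ S.perfFactorial₁ S.perfFactorial₂ S.step_map S.step_inv
      S.preStep_map hinto hψ hψp
  · exact (PreFrobenioid.isPrimaryPreStep_comp_map Ψ S.isFrobenioid₁ S.isFrobenioid₂ S.perfect₁
      S.perfect₂ S.isotropic₁ S.isotropic₂ S.perfFactorial₁ S.perfFactorial₂ S.step_map S.step_inv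
      S.preStep_map hinto hφ hφp hψ hc hψp).1

end FrdI.T42

end Literature.AlgebraicGeometry.Frobenioids
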